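import Literature.NumberTheory.Transcendental.GammaIsoTransfer
import Literature.FieldTheory.Kummer.KummerFiniteRank
import Literature.FieldTheory.Kummer.RadicalDenominators
import Mathlib.RingTheory.RootsOfUnity.AlgebraicallyClosed
import Mathlib.LinearAlgebra.FreeModule.PID
import Mathlib.RingTheory.Localization.Module
import Mathlib.LinearAlgebra.Dimension.Constructions
import Mathlib.LinearAlgebra.StdBasis
import Mathlib.Algebra.EuclideanDomain.Int
import HarnessLib

/-!
# Γ-isomorphisms from level-`0` embeddings: Kummer theory of the division points

Bays–Kirby 2018 (*Pseudo-exponential maps, variants, and quasiminimality*, Algebra & Number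
Theory 12), §3.3 ("good bases", Def. 3.19, Prop. 3.22 case (EXP)) inside a fixed exponential
field `F` with a Γ-closed base `K` (so `K₀ = ℚ(K, exp K)` is algebraically closed,
`GammaIsoTransfer.lean`). Two tools for building Γ-isomorphisms `x ↦ x'` over `K`
(`GammaField.IsGammaIso`, all levels `(x, exp (x/M!))`) from data at level `0` only:

* `GammaField.isGammaIso_of_adjoinPtFieldHom` — **Kummer-generic tuples**: if the level-`0` field
  `L₁ = K(α) = K₀(x, exp x)` embeds into `F` over `K₀` with `x ↦ x'`, `exp x ↦ exp x'`, and the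
  `exp xᵢ` are independent modulo `n`-th powers in `L₁` for every `n ≥ 1`
  (`Kummer.IndepModPowers`), then `x ↦ x'` is a Γ-isomorphism over `K`: at each level `M` the
  field `L₁(exp (x/M!))` is `L₁[T]/(Tᵢ^{M!} − exp xᵢ)` (the Kummer ideal is maximal,
  `Kummer.isMaximal_kummerIdeal`), so the embedding extends with `exp (xᵢ/M!) ↦ exp (x'ᵢ/M!)`
  (Bays–Kirby: "all division sequences of `b'` have the same ACF-type over `A(b')`, and hence
  `b'` is a good basis", proof of Prop. 3.22).
* `GammaField.exists_normalised_basis` — **existence of good bases** (Prop. 3.22, case (EXP),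
  via Prop. 3.24 = `RadicalDenominators.exists_denominator_bound`): a rational re-basing
  `(c, e) ↦ (c̃, ẽ)` of a tuple `ℚ`-linearly independent over `K`, block-triangular (`c̃ = Tc`
  spans `ℚc`), after which the exponentials are Kummer-generic over the (unchanged) level-`0`
  field.

## References

* M. Bays, J. Kirby, *Pseudo-exponential maps, variants, and quasiminimality*, Algebra & Number
  Theory 12 (2018) 493–549: Def. 3.19, Prop. 3.22, Prop. 3.24.
* S. Lang, *Algebra*, GTM 211, VI §8 (Kummer theory).
-/

noncomputable section

open Set MvPolynomial

namespace Literature.NumberTheory.Transcendental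

namespace GammaField

open Literature.ModelTheory.ExponentialFields.ExponentialRing Literature.FieldTheory.Kummer

variable {F : Type*} [Field F] [CharZero F] [Literature.ModelTheory.ExponentialFields.ExponentialRing F]
variable {K : Submodule ℚ F} {N : ℕ} {x x' : Fin N → F}

/-! ### Roots of unity in a Γ-closed base -/

/-- Roots of unity of `F` lie in every Γ-closed `K` (they are algebraic over `ℚ`).
[cite: BaysKirby2018ANT, Def. 3.8 (torsion), Lemma 4.10] -/
theorem IsGammaClosed.mem_of_pow_eq_one (hK : IsGammaClosed K) {ζ : F} {n : ℕ} (hn : 0 < n)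
    (hζ : ζ ^ n = 1) : ζ ∈ K :=
  hK.mem_of_mem_acl (mem_acl_of_pow_mem hn.ne' (by rw [hζ]; exact one_mem_acl _))

/-- A Γ-closed `K` in an algebraically closed `F` contains a primitive `n`-th root of unity for
every `n ≥ 1`. [folklore] -/
theorem IsGammaClosed.exists_isPrimitiveRoot [IsAlgClosed F] (hK : IsGammaClosed K) {n : ℕ}
    (hn : 0 < n) : ∃ ζ : F, IsPrimitiveRoot ζ n ∧ ζ ∈ K := by
  haveI : NeZero (n : F) := ⟨Nat.cast_ne_zero.2 hn.ne'⟩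
  obtain ⟨ζ, hζ⟩ := HasEnoughRootsOfUnity.exists_primitiveRoot F n
  exact ⟨ζ, hζ, hK.mem_of_pow_eq_one hn hζ.pow_eq_one⟩

/-- A Γ-closed `K` contains a square root of `−1` (in an algebraically closed `F`). [folklore] -/
theorem IsGammaClosed.exists_sq_eq_neg_one [IsAlgClosed F] (hK : IsGammaClosed K) :
    ∃ i : F, i ^ 2 = -1 ∧ i ∈ K := by
  obtain ⟨i, hi⟩ := IsAlgClosed.exists_pow_nat_eq (-1 : F) (by norm_num : 0 < 2)
  refine ⟨i, hi, hK.mem_of_pow_eq_one (by norm_num : 0 < 4) ?_⟩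
  rw [show (4 : ℕ) = 2 * 2 from rfl, pow_mul, hi]; norm_num

/-! ### The exponentials as elements of the level-`0` field -/

variable (K) in
/-- `exp xᵢ` as an element of the level-`0` field `L₁ = K₀(x, exp x)`. [folklore] -/
def expGen (x : Fin N → F) (i : Fin N) : adjoinPtField K x :=
  ⟨exp (x i), exp_apply_mem_adjoinPtField x i⟩

/-- Underlying element of `expGen`. [folklore] -/
@[simp] theorem coe_expGen (x : Fin N → F) (i : Fin N) : (expGen K x i : F) = exp (x i) := rfl

/-- `expGen K x i ≠ 0`. [folklore] -/
theorem expGen_ne_zero (x : Fin N → F) (i : Fin N) : expGen K x i ≠ 0 := fun h =>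
  exp_ne_zero (x i) (congrArg Subtype.val h)

/-- `exp (xᵢ / M!) ^ M! = exp xᵢ`. [folklore] -/
theorem exp_div_factorial_pow (z : F) (M : ℕ) :
    exp (z / (M.factorial : F)) ^ M.factorial = exp z := by
  rw [← exp_nsmul, nsmul_eq_mul, mul_div_cancel₀ _ (Nat.cast_ne_zero.2 (Nat.factorial_ne_zero M))]

/-! ### Kernels of evaluation at systems of `n`-th roots -/

section KummerKernel

variable {L : Type*} [Field L] {m : ℕ}

/-- If `rᵢⁿ = φ(aᵢ)` then the Kummer ideal of `a` is killed by `p ↦ p^φ(r)`. [folklore] -/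
theorem kummerIdeal_le_ker_eval₂Hom {S : Type*} [CommRing S] (φ : L →+* S) {n : ℕ}
    (a : Fin m → L) (r : Fin m → S) (hr : ∀ i, r i ^ n = φ (a i)) :
    kummerIdeal n a ≤ RingHom.ker (eval₂Hom φ r) := by
  rw [kummerIdeal, Ideal.span_le]
  rintro _ ⟨i, rfl⟩
  rw [SetLike.mem_coe, RingHom.mem_ker, map_sub, map_pow, eval₂Hom_X', eval₂Hom_C, hr i, sub_self]

/-- **Evaluation at a system of `n`-th roots has kernel exactly the Kummer ideal** when the
latter is maximal: `ker (p ↦ p^φ(r)) = (Tᵢⁿ − aᵢ)` for any ring homomorphism `φ : L → S` into a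
non-trivial ring and `rᵢⁿ = φ(aᵢ)`. [cite: Lang2002, VI §8 Thm 8.1] -/
theorem ker_eval₂Hom_eq_kummerIdeal {S : Type*} [Field S] (φ : L →+* S) {n : ℕ}
    (a : Fin m → L) (r : Fin m → S) (hr : ∀ i, r i ^ n = φ (a i))
    (hmax : (kummerIdeal n a).IsMaximal) :
    RingHom.ker (eval₂Hom φ r) = kummerIdeal n a :=
  (hmax.eq_of_le (RingHom.ker_ne_top _) (kummerIdeal_le_ker_eval₂Hom φ a r hr)).symm

end KummerKernel

/-! ### Γ-isomorphisms from level-`0` embeddings of Kummer-generic tuples -/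

/-- **Kummer level extension.** Let `L₁ = K₀(x, exp x)` be the level-`0` field of `x` and
`τ : L₁ → F` a ring homomorphism. If the `exp xᵢ` are independent modulo `n`-th powers in `L₁`
(`n ≥ 1`) and `K` is Γ-closed in the algebraically closed `F` (so `L₁ ⊇ K₀` contains the roots
of unity), then for any `n`-th roots `rᵢ` of `exp xᵢ` and `r'ᵢ` of `τ(exp xᵢ)` in `F`, `τ`
extends to a field embedding `L₁(r) → F` with `rᵢ ↦ r'ᵢ` (`L₁(r) ≅ L₁[T]/(Tᵢⁿ − exp xᵢ)`).
[cite: BaysKirby2018ANT, Prop. 3.22 (proof, case (EXP))] -/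
theorem exists_ringHom_adjoin_roots [IsAlgClosed F] (hK : IsGammaClosed K)
    (τ : adjoinPtField K x →+* F) {n : ℕ} (hn : 0 < n) (hind : IndepModPowers n (expGen K x))
    (r r' : Fin N → F) (hr : ∀ i, r i ^ n = exp (x i)) (hr' : ∀ i, r' i ^ n = τ (expGen K x i)) :
    ∃ ψ : IntermediateField.adjoin (adjoinPtField K x) (range r) →+* F,
      (∀ z : adjoinPtField K x, ψ (algebraMap (adjoinPtField K x) _ z) = τ z) ∧
      ∀ i, ψ ⟨r i, IntermediateField.subset_adjoin _ _ (mem_range_self i)⟩ = r' i := by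
  haveI : NeZero n := ⟨hn.ne'⟩
  -- roots of unity in `L₁`
  obtain ⟨ζ, hζ, hζK⟩ := hK.exists_isPrimitiveRoot hn
  obtain ⟨i₀, hi₀, hi₀K⟩ := hK.exists_sq_eq_neg_one
  let ζ' : adjoinPtField K x := ⟨ζ, mem_adjoinPtField_of_mem_base x hζK⟩
  have hζ' : IsPrimitiveRoot ζ' n :=
    IsPrimitiveRoot.of_map_of_injective (f := algebraMap (adjoinPtField K x) F) (by exact hζ)
      (algebraMap (adjoinPtField K x) F).injective
  have hi' : ∃ i : adjoinPtField K x, i ^ 2 = -1 :=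
    ⟨⟨i₀, mem_adjoinPtField_of_mem_base x hi₀K⟩, Subtype.ext (by simpa using hi₀)⟩
  have hmax : (kummerIdeal n (expGen K x)).IsMaximal :=
    isMaximal_kummerIdeal hζ' hi' (expGen K x) (expGen_ne_zero x) hind
  -- the two kernels are the Kummer ideal
  have hk1 : RingHom.ker (eval₂Hom (algebraMap (adjoinPtField K x) F) r) = kummerIdeal n (expGen K x) :=
    ker_eval₂Hom_eq_kummerIdeal _ _ r (fun i => by rw [hr i]; rfl) hmax
  have hk2 : RingHom.ker (eval₂Hom τ r') = kummerIdeal n (expGen K x) :=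
    ker_eval₂Hom_eq_kummerIdeal τ _ r' hr' hmax
  have hiff : ∀ p : MvPolynomial (Fin N) (adjoinPtField K x), aeval r p = 0 ↔ eval₂ τ r' p = 0 := by
    intro p
    have h1 : aeval r p = 0 ↔ p ∈ kummerIdeal n (expGen K x) := by
      rw [← hk1, RingHom.mem_ker]; rfl
    have h2 : eval₂ τ r' p = 0 ↔ p ∈ kummerIdeal n (expGen K x) := by
      rw [← hk2, RingHom.mem_ker]; rfl
    exact h1.trans h2.symm
  exact ⟨pointFieldHom τ r r' hiff, pointFieldHom_algebraMap τ r r' hiff,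
    pointFieldHom_apply_self τ r r' hiff⟩

/-- **Γ-isomorphisms from level-`0` embeddings of Kummer-generic tuples** (Bays–Kirby 2018,
Prop. 3.22, proof, case (EXP): for a good basis "all division sequences have the same ACF-type",
so the isomorphism type over the base is determined at level `0`). Let `K` be Γ-closed in the
algebraically closed `F`, `x, x' : Fin N → F`, and suppose the level-`0` field
`L₁ = K₀(x, exp x)` admits a ring homomorphism `τ : L₁ → F` fixing `K₀` pointwise with
`τ xᵢ = x'ᵢ`, `τ (exp xᵢ) = exp x'ᵢ`. If the `exp xᵢ` are independent modulo `n`-th powers in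
`L₁` for every `n ≥ 1`, then `x ↦ x'` is a Γ-isomorphism over `K`: at level `M`, `τ` extends to
`L₁(exp (x/M!)) → F` with `exp (xᵢ/M!) ↦ exp (x'ᵢ/M!)` (`exists_ringHom_adjoin_roots` with
`n = M!`), whence `(x, exp (x/M!))` and `(x', exp (x'/M!))` have the same ideal over `K₀`.
[cite: BaysKirby2018ANT, Prop. 3.22 (proof, case (EXP)), Def. 3.19] -/
theorem isGammaIso_of_adjoinPtFieldHom [IsAlgClosed F] (hK : IsGammaClosed K)
    (τ : adjoinPtField K x →+* F)
    (hτK : ∀ (z : F) (hz : z ∈ fieldOf K), τ ⟨z, mem_adjoinPtField_of_mem_fieldOf x hz⟩ = z)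
    (hτx : ∀ i, τ ⟨x i, apply_mem_adjoinPtField x i⟩ = x' i)
    (hτe : ∀ i, τ (expGen K x i) = exp (x' i))
    (hind : ∀ n, 0 < n → IndepModPowers n (expGen K x)) :
    IsGammaIso K x x' := by
  rw [isGammaIso_iff_ker_eq]
  intro M
  set n := M.factorial with hn
  have hnpos : 0 < n := Nat.factorial_pos M
  set r : Fin N → F := fun i => exp (x i / (n : F)) with hr
  set r' : Fin N → F := fun i => exp (x' i / (n : F)) with hr'
  have hex := exists_ringHom_adjoin_roots hK τ hnpos (hind n hnpos) r r'
    (fun i => exp_div_factorial_pow (x i) M) (fun i => by rw [hτe]; exact exp_div_factorial_pow (x' i) M)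
  set E := IntermediateField.adjoin (adjoinPtField K x) (range r) with hE
  obtain ⟨ψ, hψL, hψr⟩ := hex
  -- the level-`M` generators inside `E`
  have hmem : ∀ j, lvGens M x j ∈ E := by
    rintro (i | i)
    · exact (IntermediateField.algebraMap_mem E ⟨x i, apply_mem_adjoinPtField x i⟩ : (x i) ∈ E)
    · exact IntermediateField.subset_adjoin _ _ (mem_range_self i)
  let g : Fin N ⊕ Fin N → E := fun j => ⟨lvGens M x j, hmem j⟩
  have hg : ∀ j, ((g j : E) : F) = lvGens M x j := fun _ => rfl
  -- `ψ ∘ g = lvGens M x'`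
  have hψg : ∀ j, ψ (g j) = lvGens M x' j := by
    rintro (i | i)
    · have : g (Sum.inl i) = algebraMap (adjoinPtField K x) E ⟨x i, apply_mem_adjoinPtField x i⟩ := rfl
      rw [this, hψL, hτx, lvGens_inl]
    · exact hψr i
  -- `ψ` is the identity on `K₀`
  let ιK : fieldOf K →+* E := (algebraMap (adjoinPtField K x) E).comp (algebraMap (fieldOf K) (adjoinPtField K x))
  have hιK : ∀ k : fieldOf K, ((ιK k : E) : F) = k := fun _ => rfl
  have hψK : ∀ k : fieldOf K, ψ (ιK k) = k := fun k => by
    show ψ (algebraMap (adjoinPtField K x) E (algebraMap (fieldOf K) (adjoinPtField K x) k)) = k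
    rw [hψL]
    exact hτK k k.2
  -- evaluation inside `E`
  have key : ∀ P : MvPolynomial (Fin N ⊕ Fin N) (fieldOf K),
      ((eval₂ ιK g P : E) : F) = aeval (lvGens M x) P ∧ ψ (eval₂ ιK g P) = aeval (lvGens M x') P := by
    intro P
    constructor
    · rw [show ((eval₂ ιK g P : E) : F) = (algebraMap E F) (eval₂ ιK g P) from rfl,
        eval₂_comp_left, aeval_def]
      rfl
    · rw [eval₂_comp_left, aeval_def]
      congr 1
      · ext k; exact hψK k
      · funext j; exact hψg j
  ext P
  rw [RingHom.mem_ker, RingHom.mem_ker]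
  change aeval (lvGens M x) P = 0 ↔ aeval (lvGens M x') P = 0
  rw [← (key P).1, ← (key P).2]
  constructor
  · intro h
    have : eval₂ ιK g P = 0 := Subtype.ext h
    rw [this, map_zero]
  · intro h
    have : eval₂ ιK g P = 0 := (injective_iff_map_eq_zero ψ).1 ψ.injective _ h
    rw [this]; rfl

end GammaField

/-! ### Lattices in `ℚⁿ` -/

section Lattice

/-- The standard basis vectors of `ℚⁿ` are `ℤ`-linearly independent. [folklore] -/
theorem linearIndependent_rat_single (n : ℕ) :
    LinearIndependent ℚ (fun i : Fin n => (Pi.single i 1 : Fin n → ℚ)) := by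
  classical
  have h := (Pi.basisFun ℚ (Fin n)).linearIndependent
  have e : ⇑(Pi.basisFun ℚ (Fin n)) = fun i : Fin n => (Pi.single i 1 : Fin n → ℚ) := by
    funext i; rw [Pi.basisFun_apply]
  rwa [e] at h

/-- The standard basis vectors of `ℚⁿ` are `ℤ`-linearly independent. [folklore] -/
theorem linearIndependent_int_single (n : ℕ) :
    LinearIndependent ℤ (fun i : Fin n => (Pi.single i 1 : Fin n → ℚ)) :=
  (LinearIndependent.iff_fractionRing ℤ ℚ).2 (linearIndependent_rat_single n)

/-- **Full-rank lattices in `ℚⁿ` are free of rank `n`.** A subgroup `Λ ≤ ℚⁿ` containing the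
standard basis vectors and with bounded denominators (`m₀ Λ ⊆ ℤⁿ`) has a `ℤ`-basis indexed by
`Fin n` (a submodule of the free `ℤ`-module `(1/m₀)ℤⁿ`, `Submodule.basisOfPidOfLE`, squeezed
between two free modules of rank `n`). [folklore] -/
theorem nonempty_basis_of_lattice {n : ℕ} (Λ : Submodule ℤ (Fin n → ℚ)) {m₀ : ℕ} (hm₀ : 0 < m₀)
    (hstd : ∀ i, (Pi.single i 1 : Fin n → ℚ) ∈ Λ)
    (hden : ∀ q ∈ Λ, ∀ i, ∃ z : ℤ, (m₀ : ℚ) * q i = z) :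
    Nonempty (Module.Basis (Fin n) ℤ Λ) := by
  classical
  have hm₀Q : (m₀ : ℚ) ≠ 0 := Nat.cast_ne_zero.2 hm₀.ne'
  -- the scaled standard basis `vᵢ = (1/m₀) eᵢ`
  let v : Fin n → (Fin n → ℚ) := fun i => Pi.single i ((m₀ : ℚ)⁻¹)
  have hv : ∀ i, v i = (m₀ : ℚ)⁻¹ • (Pi.single i 1 : Fin n → ℚ) := fun i => by
    simp only [v, ← Pi.single_smul, smul_eq_mul, mul_one]
  have hvQ : LinearIndependent ℚ v := by
    have h0 := linearIndependent_rat_single n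
    have := h0.units_smul (fun _ => Units.mk0 ((m₀ : ℚ)⁻¹) (inv_ne_zero hm₀Q))
    convert this using 1
    funext i
    rw [hv i]
    rfl
  have hvZ : LinearIndependent ℤ v := (LinearIndependent.iff_fractionRing ℤ ℚ).2 hvQ
  let O : Submodule ℤ (Fin n → ℚ) := Submodule.span ℤ (range v)
  let bO : Module.Basis (Fin n) ℤ O := Module.Basis.span hvZ
  -- `Λ ≤ O`
  have hΛO : Λ ≤ O := by
    intro q hq
    choose z hz using hden q hq
    have hq' : q = ∑ i, (z i : ℤ) • v i := by
      have h1 : (∑ i, (z i : ℤ) • v i) = ∑ i, Pi.single i ((z i : ℚ) * (m₀ : ℚ)⁻¹) := by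
        refine Finset.sum_congr rfl fun i _ => ?_
        rw [zsmul_eq_mul, show ((z i : ℤ) : Fin n → ℚ) = fun _ => (z i : ℚ) from rfl]
        funext j
        simp only [Pi.mul_apply, v, Pi.single_apply]
        split_ifs <;> simp
      rw [h1, Finset.univ_sum_single]
      funext j
      have := hz j
      rw [eq_mul_inv_iff_mul_eq₀ hm₀Q, mul_comm]
      exact this
    rw [hq']
    exact Submodule.sum_mem _ fun i _ =>
      Submodule.smul_mem _ _ (Submodule.subset_span (mem_range_self i))
  obtain ⟨m, bΛ⟩ := Submodule.basisOfPidOfLE hΛO bO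
  -- rank count: `n ≤ m ≤ n`
  haveI : Module.Finite ℤ O := Module.Finite.of_basis bO
  haveI : Module.Finite ℤ Λ := Module.Finite.of_basis bΛ
  have h1 : Module.finrank ℤ Λ ≤ n := by
    have := Submodule.finrank_mono hΛO
    rwa [Module.finrank_eq_card_basis bO, Fintype.card_fin] at this
  have h2 : n ≤ Module.finrank ℤ Λ := by
    let Λ₀ : Submodule ℤ (Fin n → ℚ) :=
      Submodule.span ℤ (range fun i : Fin n => (Pi.single i 1 : Fin n → ℚ))
    let b₀ : Module.Basis (Fin n) ℤ Λ₀ := Module.Basis.span (linearIndependent_int_single n)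
    have hle : Λ₀ ≤ Λ := Submodule.span_le.2 (by rintro _ ⟨i, rfl⟩; exact hstd i)
    have := Submodule.finrank_mono hle
    rwa [Module.finrank_eq_card_basis b₀, Fintype.card_fin] at this
  have hm : m = n := by
    have := Module.finrank_eq_card_basis bΛ
    rw [Fintype.card_fin] at this
    omega
  exact ⟨bΛ.reindex (finCongr hm)⟩

end Lattice

namespace GammaField

open Literature.ModelTheory.ExponentialFields.ExponentialRing Literature.FieldTheory.Kummer

variable {F : Type*} [Field F] [CharZero F] [Literature.ModelTheory.ExponentialFields.ExponentialRing F]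
variable {K : Submodule ℚ F}

/-! ### The pairing `⟪q, x⟫ = ∑ qₛ xₛ` and `exp` of sums -/

section Pairing

variable {n : ℕ}

omit [CharZero F] in
/-- `exp` of a finite sum is the product of the exponentials. [folklore] -/
theorem exp_finset_sum {ι : Type*} (s : Finset ι) (f : ι → F) :
    exp (∑ i ∈ s, f i) = ∏ i ∈ s, exp (f i) := by
  classical
  induction s using Finset.induction_on with
  | empty => simp
  | insert i s hi ih => rw [Finset.sum_insert hi, Finset.prod_insert hi, exp_add, ih]

/-- The `ℚ`-linear pairing `⟪q, x⟫ = ∑ₛ qₛ • xₛ` of a rational vector with a tuple. [folklore] -/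
def pairing (x : Fin n → F) (q : Fin n → ℚ) : F := ∑ s, q s • x s

omit [Literature.ModelTheory.ExponentialFields.ExponentialRing F] in
/-- Additivity of the pairing. [folklore] -/
theorem pairing_add (x : Fin n → F) (q q' : Fin n → ℚ) :
    pairing x (q + q') = pairing x q + pairing x q' := by
  simp only [pairing, Pi.add_apply, add_smul, Finset.sum_add_distrib]

omit [Literature.ModelTheory.ExponentialFields.ExponentialRing F] in
/-- The pairing with `0`. [folklore] -/
@[simp] theorem pairing_zero (x : Fin n → F) : pairing x 0 = 0 := by simp [pairing]

omit [Literature.ModelTheory.ExponentialFields.ExponentialRing F] in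
/-- Homogeneity of the pairing. [folklore] -/
theorem pairing_smul (x : Fin n → F) (r : ℚ) (q : Fin n → ℚ) :
    pairing x (r • q) = r • pairing x q := by
  simp only [pairing, Pi.smul_apply, smul_eq_mul, mul_smul, Finset.smul_sum]

omit [Literature.ModelTheory.ExponentialFields.ExponentialRing F] in
/-- Integer homogeneity of the pairing. [folklore] -/
theorem pairing_zsmul (x : Fin n → F) (z : ℤ) (q : Fin n → ℚ) :
    pairing x (z • q) = z • pairing x q := by
  rw [← Int.cast_smul_eq_zsmul ℚ z q, pairing_smul, Int.cast_smul_eq_zsmul]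

omit [Literature.ModelTheory.ExponentialFields.ExponentialRing F] in
/-- The pairing with a standard basis vector. [folklore] -/
@[simp] theorem pairing_single (x : Fin n → F) (s : Fin n) (r : ℚ) :
    pairing x (Pi.single s r) = r • x s := by
  classical
  simp only [pairing, Pi.single_apply, ite_smul, zero_smul, Finset.sum_ite_eq', Finset.mem_univ,
    if_true]

omit [Literature.ModelTheory.ExponentialFields.ExponentialRing F] in
/-- The pairing with a linear combination of vectors. [folklore] -/
theorem pairing_sum {ι : Type*} (x : Fin n → F) (t : Finset ι) (f : ι → Fin n → ℚ) :
    pairing x (∑ i ∈ t, f i) = ∑ i ∈ t, pairing x (f i) := by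
  classical
  induction t using Finset.induction_on with
  | empty => simp
  | insert i t hi ih => rw [Finset.sum_insert hi, Finset.sum_insert hi, pairing_add, ih]

omit [Literature.ModelTheory.ExponentialFields.ExponentialRing F] in
/-- The pairing lands in the `ℚ`-span of the tuple. [folklore] -/
theorem pairing_mem_span (x : Fin n → F) (q : Fin n → ℚ) :
    pairing x q ∈ Submodule.span ℚ (range x) :=
  Submodule.sum_mem _ fun s _ => Submodule.smul_mem _ _ (Submodule.subset_span (mem_range_self s))

/-- `exp ⟪z, x⟫ = ∏ (exp xₛ)^{zₛ}` for an integer vector `z`. [folklore] -/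
theorem exp_pairing_intCast (x : Fin n → F) (z : Fin n → ℤ) :
    exp (pairing x fun s => (z s : ℚ)) = ∏ s, exp (x s) ^ z s := by
  rw [pairing, exp_finset_sum]
  refine Finset.prod_congr rfl fun s _ => ?_
  rw [Int.cast_smul_eq_zsmul, exp_zsmul]

/-- `(exp ⟪q, x⟫)^m = exp ⟪m q, x⟫`. [folklore] -/
theorem exp_pairing_pow (x : Fin n → F) (q : Fin n → ℚ) (m : ℕ) :
    exp (pairing x q) ^ m = exp (pairing x ((m : ℚ) • q)) := by
  rw [pairing_smul, ← exp_nsmul, Nat.cast_smul_eq_nsmul]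

omit [Literature.ModelTheory.ExponentialFields.ExponentialRing F] in
/-- A pairing with `Fin.append c e` splits into the two blocks. [folklore] -/
theorem pairing_append {N k : ℕ} (c : Fin N → F) (e : Fin k → F) (q : Fin (N + k) → ℚ) :
    pairing (Fin.append c e) q =
      ∑ i, q (Fin.castAdd k i) • c i + ∑ j, q (Fin.natAdd N j) • e j := by
  rw [pairing, Fin.sum_univ_add]
  simp only [Fin.append_left, Fin.append_right]

end Pairing

/-! ### The Kummer lattice of a tuple -/

section KummerLattice

variable {n : ℕ}

variable (K) in
/-- **The Kummer lattice** of a tuple `x`: the rational vectors `q` with `exp ⟪q, x⟫` in the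
level-`0` field `L₁ = K₀(x, exp x)` — the group `Φ̄` of exponents of radicals of monomials in
`exp x` lying in `L₁` (up to roots of unity, which lie in `K₀`). It contains `ℤⁿ`.
[cite: BaysKirby2018ANT, Prop. 3.22 (proof), Prop. 3.24] -/
def kummerLattice (x : Fin n → F) : Submodule ℤ (Fin n → ℚ) where
  carrier := {q | exp (pairing x q) ∈ adjoinPtField K x}
  add_mem' {q q'} hq hq' := by
    simp only [mem_setOf_eq] at hq hq' ⊢
    rw [pairing_add, exp_add]
    exact mul_mem hq hq'
  zero_mem' := by simp only [mem_setOf_eq, pairing_zero, exp_zero]; exact one_mem _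
  smul_mem' z q hq := by
    simp only [mem_setOf_eq] at hq ⊢
    rw [pairing_zsmul, exp_zsmul]
    exact zpow_mem hq z

/-- Membership in the Kummer lattice. [folklore] -/
theorem mem_kummerLattice_iff (x : Fin n → F) (q : Fin n → ℚ) :
    q ∈ kummerLattice K x ↔ exp (pairing x q) ∈ adjoinPtField K x := Iff.rfl

/-- The standard basis vectors lie in the Kummer lattice (`exp xₛ ∈ L₁`). [folklore] -/
theorem single_mem_kummerLattice (x : Fin n → F) (s : Fin n) :
    (Pi.single s 1 : Fin n → ℚ) ∈ kummerLattice K x := by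
  rw [mem_kummerLattice_iff, pairing_single, one_smul]
  exact exp_apply_mem_adjoinPtField x s

/-- The level-`0` field is finitely generated over `K₀`. [folklore] -/
theorem adjoinPtField_fg (x : Fin n → F) :
    ∃ s : Finset (adjoinPtField K x), IntermediateField.adjoin (fieldOf K) (s : Set (adjoinPtField K x)) = ⊤ := by
  classical
  let g : Fin n ⊕ Fin n → adjoinPtField K x := fun j => ⟨lvGens 0 x j, lvGens_zero_mem_adjoinPtField x j⟩
  refine ⟨Finset.univ.image g, ?_⟩
  apply IntermediateField.lift_injective
  rw [IntermediateField.lift_adjoin, IntermediateField.lift_top]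
  congr 1
  ext z
  simp only [Finset.coe_image, Finset.coe_univ, image_univ, mem_image, mem_range]
  constructor
  · rintro ⟨_, ⟨j, rfl⟩, rfl⟩; exact ⟨j, rfl⟩
  · rintro ⟨j, rfl⟩; exact ⟨g j, ⟨j, rfl⟩, rfl⟩

/-- Over an algebraically closed `K₀`, the elements of `L₁` algebraic over `K₀` are in `K₀`.
[folklore] -/
theorem mem_range_algebraMap_of_isAlgebraic [IsAlgClosed F] (hK : IsGammaClosed K) (x : Fin n → F)
    (z : adjoinPtField K x) (hz : IsAlgebraic (fieldOf K) z) :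
    z ∈ range (algebraMap (fieldOf K) (adjoinPtField K x)) := by
  haveI := hK.isAlgClosed_fieldOf
  refine minpoly.mem_range_of_degree_eq_one (fieldOf K) z ?_
  exact IsAlgClosed.degree_eq_one_of_irreducible (fieldOf K)
    (minpoly.irreducible hz.isIntegral)

/-- A common denominator for a rational vector. [folklore] -/
theorem exists_common_den (q : Fin n → ℚ) :
    ∃ d : ℕ, 0 < d ∧ ∃ v : Fin n → ℤ, ∀ s, (d : ℚ) * q s = v s := by
  classical
  refine ⟨∏ s, (q s).den, Finset.prod_pos fun s _ => (q s).den_pos, fun s =>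
    (∏ t ∈ Finset.univ.erase s, ((q t).den : ℤ)) * (q s).num, fun s => ?_⟩
  rw [← Finset.prod_erase_mul _ _ (Finset.mem_univ s), Nat.cast_mul, mul_assoc,
    show ((q s).den : ℚ) * q s = (q s).num by rw [mul_comm, Rat.mul_den_eq_num]]
  push_cast
  ring

/-- **Bounded denominators** (Bays–Kirby 2018, Prop. 3.24 via
`RadicalDenominators.exists_denominator_bound`): if `x` is `ℚ`-linearly independent over the
Γ-closed `K`, the Kummer lattice of `x` lies in `(1/m₀) ℤⁿ` for some `m₀ ≥ 1`.
[cite: BaysKirby2018ANT, Prop. 3.24] -/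
theorem exists_den_kummerLattice [IsAlgClosed F] (hK : IsGammaClosed K) (x : Fin n → F)
    (hx : LinIndepOver K x) :
    ∃ m₀ : ℕ, 0 < m₀ ∧ ∀ q ∈ kummerLattice K x, ∀ s, ∃ z : ℤ, (m₀ : ℚ) * q s = z := by
  classical
  set L := adjoinPtField K x with hL
  let a : Fin n → (adjoinPtField K x)ˣ := fun s => Units.mk0 (expGen K x s) (expGen_ne_zero x s)
  have ha : ∀ s, ((a s : adjoinPtField K x) : F) = exp (x s) := fun _ => rfl
  -- multiplicative independence modulo `K₀ˣ`
  have hind : ∀ w : Fin n → ℤ, ((∏ i, a i ^ w i : (adjoinPtField K x)ˣ) : adjoinPtField K x) ∈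
      range (algebraMap (fieldOf K) (adjoinPtField K x)) → w = 0 := by
    rintro w ⟨k, hk⟩
    have hkF : (k : F) = ∏ s, exp (x s) ^ w s := by
      have := congrArg (fun z : adjoinPtField K x => (z : F)) hk
      rw [show ((algebraMap (fieldOf K) (adjoinPtField K x) k : adjoinPtField K x) : F) = k from rfl] at this
      rw [this, Units.coe_prod]
      rw [show ((∏ i, (↑(a i ^ w i) : adjoinPtField K x) : adjoinPtField K x) : F) =
        ∏ i, (((↑(a i ^ w i) : adjoinPtField K x)) : F) from map_prod (algebraMap (adjoinPtField K x) F) _ _]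
      refine Finset.prod_congr rfl fun s _ => ?_
      rw [Units.val_zpow_eq_zpow_val]
      rw [show (((a s : adjoinPtField K x) ^ w s : adjoinPtField K x) : F) = ((a s : adjoinPtField K x) : F) ^ w s from
        map_zpow₀ (algebraMap (adjoinPtField K x) F) _ _, ha]
    have hexp : exp (pairing x fun s => (w s : ℚ)) ∈ acl (gens K) := by
      rw [exp_pairing_intCast, ← hkF]
      exact fieldOf_subset_acl K k.2
    have hmem : (pairing x fun s => (w s : ℚ)) ∈ K := hK.mem_of_exp_mem_acl hexp
    have := hx (fun s => (w s : ℚ)) hmem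
    funext s
    have h := congrFun this s
    rw [Pi.zero_apply, Int.cast_eq_zero] at h
    rw [h, Pi.zero_apply]
  obtain ⟨m₀, hm₀, hdvd⟩ := RadicalDenominators.exists_denominator_bound (adjoinPtField_fg x)
    (mem_range_algebraMap_of_isAlgebraic hK x) a hind
  refine ⟨m₀, hm₀, fun q hq s => ?_⟩
  -- clear denominators: `d q = v` integral
  obtain ⟨d, hd, v, hv⟩ := exists_common_den q
  have hdq : (d : ℚ) • q = fun s => (v s : ℚ) := funext fun s => by rw [Pi.smul_apply, smul_eq_mul, hv s]
  -- the unit `y = exp ⟪q, x⟫` of `L₁` with `y^d = ∏ aₛ^{vₛ}`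
  let y : (adjoinPtField K x)ˣ := Units.mk0 ⟨exp (pairing x q), hq⟩
    (fun h => exp_ne_zero _ (congrArg Subtype.val h))
  have hy : y ^ d = ∏ s, a s ^ v s := by
    apply Units.ext
    apply Subtype.ext
    show (((y ^ d : (adjoinPtField K x)ˣ) : adjoinPtField K x) : F) = (((∏ s, a s ^ v s : (adjoinPtField K x)ˣ) : adjoinPtField K x) : F)
    rw [Units.val_pow_eq_pow_val, Units.coe_prod]
    rw [show ((((y : adjoinPtField K x) ^ d : adjoinPtField K x)) : F) = ((y : adjoinPtField K x) : F) ^ d from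
      map_pow (algebraMap (adjoinPtField K x) F) _ _]
    rw [show ((∏ i, (↑(a i ^ v i) : adjoinPtField K x) : adjoinPtField K x) : F) =
        ∏ i, (((↑(a i ^ v i) : adjoinPtField K x)) : F) from map_prod (algebraMap (adjoinPtField K x) F) _ _]
    have e1 : ((y : adjoinPtField K x) : F) = exp (pairing x q) := rfl
    rw [e1, exp_pairing_pow, hdq, exp_pairing_intCast]
    refine Finset.prod_congr rfl fun s _ => ?_
    rw [Units.val_zpow_eq_zpow_val]
    rw [show (((a s : adjoinPtField K x) ^ v s : adjoinPtField K x) : F) = ((a s : adjoinPtField K x) : F) ^ v s from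
      map_zpow₀ (algebraMap (adjoinPtField K x) F) _ _, ha]
  have hds := hdvd d v y hy s
  -- `m₀ qₛ = m₀ vₛ / d ∈ ℤ`
  obtain ⟨t, ht⟩ := hds
  refine ⟨t, ?_⟩
  have hdQ : (d : ℚ) ≠ 0 := Nat.cast_ne_zero.2 hd.ne'
  have : (d : ℚ) * ((m₀ : ℚ) * q s) = (d : ℚ) * t := by
    rw [mul_left_comm, hv s]
    exact_mod_cast ht
  exact mul_left_cancel₀ hdQ this

end KummerLattice

/-! ### Block maps on `ℚ^{N+k} = ℚ^N × ℚ^k` -/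

section Blocks

variable {N k : ℕ}

/-- `castAdd i ≠ natAdd j` in `Fin (N + k)`. [folklore] -/
theorem fin_castAdd_ne_natAdd (i : Fin N) (j : Fin k) : (Fin.castAdd k i : Fin (N + k)) ≠ Fin.natAdd N j := by
  intro h
  have := congrArg Fin.val h
  simp only [Fin.val_castAdd, Fin.val_natAdd] at this
  omega

/-- The inclusion `ℚ^N → ℚ^{N+k}`, `t ↦ (t, 0)`, as a `ℤ`-linear map. [folklore] -/
def blockIncl (N k : ℕ) : (Fin N → ℚ) →ₗ[ℤ] (Fin (N + k) → ℚ) where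
  toFun t := Fin.append t 0
  map_add' t t' := by
    funext s; refine Fin.addCases (fun i => ?_) (fun j => ?_) s <;> simp
  map_smul' z t := by
    funext s; refine Fin.addCases (fun i => ?_) (fun j => ?_) s <;> simp

/-- `blockIncl t` on the first block. [folklore] -/
@[simp] theorem blockIncl_castAdd (t : Fin N → ℚ) (i : Fin N) :
    blockIncl N k t (Fin.castAdd k i) = t i := Fin.append_left t 0 i

/-- `blockIncl t` on the second block. [folklore] -/
@[simp] theorem blockIncl_natAdd (t : Fin N → ℚ) (j : Fin k) :
    blockIncl N k t (Fin.natAdd N j) = 0 := Fin.append_right t 0 j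

/-- `blockIncl` is injective. [folklore] -/
theorem blockIncl_injective : Function.Injective (blockIncl N k) := fun t t' h => by
  funext i
  have := congrFun h (Fin.castAdd k i)
  simpa using this

/-- The projection `ℚ^{N+k} → ℚ^N` onto the first block. [folklore] -/
def blockFst (N k : ℕ) : (Fin (N + k) → ℚ) →ₗ[ℤ] (Fin N → ℚ) := LinearMap.funLeft ℤ ℚ (Fin.castAdd k)

/-- The projection `ℚ^{N+k} → ℚ^k` onto the second block. [folklore] -/
def blockSnd (N k : ℕ) : (Fin (N + k) → ℚ) →ₗ[ℤ] (Fin k → ℚ) := LinearMap.funLeft ℤ ℚ (Fin.natAdd N)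

/-- `blockFst q i = q (castAdd i)`. [folklore] -/
@[simp] theorem blockFst_apply (q : Fin (N + k) → ℚ) (i : Fin N) : blockFst N k q i = q (Fin.castAdd k i) := rfl

/-- `blockSnd q j = q (natAdd j)`. [folklore] -/
@[simp] theorem blockSnd_apply (q : Fin (N + k) → ℚ) (j : Fin k) : blockSnd N k q j = q (Fin.natAdd N j) := rfl

/-- `blockSnd ∘ blockIncl = 0`. [folklore] -/
@[simp] theorem blockSnd_blockIncl (t : Fin N → ℚ) : blockSnd N k (blockIncl N k t) = 0 := by
  funext j; simp

/-- `blockFst ∘ blockIncl = id`. [folklore] -/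
@[simp] theorem blockFst_blockIncl (t : Fin N → ℚ) : blockFst N k (blockIncl N k t) = t := by
  funext i; simp

/-- A vector with vanishing second block comes from the first block. [folklore] -/
theorem blockIncl_blockFst_of_blockSnd_eq_zero {q : Fin (N + k) → ℚ} (h : blockSnd N k q = 0) :
    blockIncl N k (blockFst N k q) = q := by
  funext s
  refine Fin.addCases (fun i => ?_) (fun j => ?_) s
  · simp
  · rw [blockIncl_natAdd]
    have := congrFun h j
    simpa using this.symm

/-- `blockIncl` of a standard basis vector. [folklore] -/
theorem blockIncl_single (i : Fin N) :
    blockIncl N k (Pi.single i 1) = Pi.single (Fin.castAdd k i) 1 := by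
  classical
  funext s
  refine Fin.addCases (fun i' => ?_) (fun j => ?_) s
  · rw [blockIncl_castAdd, Pi.single_apply, Pi.single_apply]
    simp only [Fin.castAdd_inj]
  · rw [blockIncl_natAdd, Pi.single_apply, if_neg (fin_castAdd_ne_natAdd i j).symm]

/-- `blockSnd` of a standard basis vector of the second block. [folklore] -/
theorem blockSnd_single_natAdd (j : Fin k) :
    blockSnd N k (Pi.single (Fin.natAdd N j) (1 : ℚ)) = Pi.single j 1 := by
  classical
  funext j'
  rw [blockSnd_apply, Pi.single_apply, Pi.single_apply]
  simp only [Fin.natAdd_inj]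

omit [Literature.ModelTheory.ExponentialFields.ExponentialRing F] in
/-- The pairing with `blockIncl t` only involves the first block. [folklore] -/
theorem pairing_append_blockIncl (c : Fin N → F) (e : Fin k → F) (t : Fin N → ℚ) :
    pairing (Fin.append c e) (blockIncl N k t) = pairing c t := by
  rw [pairing_append]
  simp [pairing]

end Blocks

/-! ### Good bases: normalisation of a tuple -/

section GoodBasis

variable [IsAlgClosed F] {N k : ℕ}

/-- **Existence of good bases** (Bays–Kirby 2018, Prop. 3.22, case (EXP), via Prop. 3.24). Let
`K` be Γ-closed in the algebraically closed `F` and `(c, e)` a tuple `ℚ`-linearly independent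
over `K`. There is a rational re-basing `(c, e) ↦ (c', e')`, block-triangular — `c'` is a basis of
`ℚc` with `c` integral over it, `e'` lies in `ℚ(c, e)` and `(c, e)` is integral over `(c', e')` —
with the same level-`0` field `L₁ = K₀(c, e, exp c, exp e)`, such that the exponentials
`exp c', exp e'` are independent modulo `m`-th powers in `L₁` for every `m ≥ 1`
(`Kummer.IndepModPowers`): the coordinate vectors of `(c', e')` are a `ℤ`-basis of the Kummer
lattice `{q : exp ⟪q, (c, e)⟫ ∈ L₁}` adapted to its intersection with `ℚ^N × 0`.
[cite: BaysKirby2018ANT, Prop. 3.22 (case (EXP)), Prop. 3.24] -/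
theorem exists_normalised_basis (hK : IsGammaClosed K) (c : Fin N → F) (e : Fin k → F)
    (hind : LinIndepOver K (Fin.append c e)) :
    ∃ (c' : Fin N → F) (e' : Fin k → F),
      (∀ i, c' i ∈ Submodule.span ℚ (range c)) ∧
      (∀ i, ∃ z : Fin N → ℤ, c i = ∑ l, (z l : ℚ) • c' l) ∧
      (∀ j, e' j ∈ Submodule.span ℚ (range (Fin.append c e))) ∧
      (∀ s, ∃ z : Fin (N + k) → ℤ, Fin.append c e s = ∑ r, (z r : ℚ) • Fin.append c' e' r) ∧
      adjoinPtField K (Fin.append c' e') = adjoinPtField K (Fin.append c e) ∧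
      ∀ m, 0 < m → IndepModPowers m (expGen K (Fin.append c' e')) := by
  classical
  set x := Fin.append c e with hxdef
  set Φ := kummerLattice K x with hΦ
  obtain ⟨m₀, hm₀, hden⟩ := exists_den_kummerLattice hK x hind
  -- the two auxiliary lattices
  let Φ₁ : Submodule ℤ (Fin N → ℚ) := Φ.comap (blockIncl N k)
  let Ψ : Submodule ℤ (Fin k → ℚ) := Φ.map (blockSnd N k)
  have hΦ₁mem : ∀ t, t ∈ Φ₁ ↔ blockIncl N k t ∈ Φ := fun _ => Iff.rfl
  obtain ⟨t⟩ : Nonempty (Module.Basis (Fin N) ℤ Φ₁) := by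
    refine Transcendental.nonempty_basis_of_lattice Φ₁ hm₀ (fun i => ?_) (fun q hq i => ?_)
    · rw [hΦ₁mem, blockIncl_single]; exact single_mem_kummerLattice x _
    · obtain ⟨z, hz⟩ := hden _ hq (Fin.castAdd k i)
      exact ⟨z, by rwa [blockIncl_castAdd] at hz⟩
  obtain ⟨u⟩ : Nonempty (Module.Basis (Fin k) ℤ Ψ) := by
    refine Transcendental.nonempty_basis_of_lattice Ψ hm₀ (fun j => ?_) (fun q hq j => ?_)
    · exact ⟨Pi.single (Fin.natAdd N j) 1, single_mem_kummerLattice x _, blockSnd_single_natAdd j⟩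
    · obtain ⟨q', hq', rfl⟩ := hq
      obtain ⟨z, hz⟩ := hden _ hq' (Fin.natAdd N j)
      exact ⟨z, hz⟩
  -- lifts of the `u j`
  have hlift : ∀ j, ∃ v : Fin (N + k) → ℚ, v ∈ Φ ∧ blockSnd N k v = (u j : Fin k → ℚ) := fun j => by
    obtain ⟨v, hv, hv'⟩ := (u j).2
    exact ⟨v, hv, hv'⟩
  choose v hvΦ hvu using hlift
  -- the adapted basis `B`
  let B : Fin (N + k) → (Fin (N + k) → ℚ) := Fin.append (fun i => blockIncl N k (t i : Fin N → ℚ)) v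
  have hBl : ∀ i, B (Fin.castAdd k i) = blockIncl N k (t i : Fin N → ℚ) := fun i => Fin.append_left _ _ i
  have hBr : ∀ j, B (Fin.natAdd N j) = v j := fun j => Fin.append_right _ _ j
  have hBΦ : ∀ r, B r ∈ Φ := fun r => by
    refine Fin.addCases (fun i => ?_) (fun j => ?_) r
    · rw [hBl]; exact (hΦ₁mem _).1 (t i).2
    · rw [hBr]; exact hvΦ j
  -- linear independence of the bases inside the ambient spaces
  have htli : LinearIndependent ℤ (fun i => (t i : Fin N → ℚ)) :=
    t.linearIndependent.map' Φ₁.subtype (Submodule.ker_subtype _)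
  have huli : LinearIndependent ℤ (fun j => (u j : Fin k → ℚ)) :=
    u.linearIndependent.map' Ψ.subtype (Submodule.ker_subtype _)
  -- second-block coefficients of a combination of the `B r` are read off through `blockSnd`
  have hsnd : ∀ z : Fin (N + k) → ℤ,
      blockSnd N k (∑ r, z r • B r) = ∑ j, z (Fin.natAdd N j) • (u j : Fin k → ℚ) := fun z => by
    rw [map_sum, Fin.sum_univ_add]
    simp only [map_zsmul, hBl, hBr, blockSnd_blockIncl, smul_zero, Finset.sum_const_zero, zero_add, hvu]
  have hker : ∀ z : Fin (N + k) → ℤ, blockSnd N k (∑ r, z r • B r) = 0 →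
      ∀ j, z (Fin.natAdd N j) = 0 := fun z hz => by
    rw [hsnd] at hz
    exact fun j => Fintype.linearIndependent_iff.1 huli (fun j => z (Fin.natAdd N j)) hz j
  -- `B` is `ℤ`-linearly independent, hence `ℚ`-linearly independent
  have hBli : LinearIndependent ℤ B := by
    refine Fintype.linearIndependent_iff.2 fun z hz => ?_
    have h2 : ∀ j, z (Fin.natAdd N j) = 0 := hker z (by rw [hz, map_zero])
    have h1 : ∀ i, z (Fin.castAdd k i) = 0 := by
      have hz' : ∑ i, z (Fin.castAdd k i) • blockIncl N k (t i : Fin N → ℚ) = 0 := by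
        rw [Fin.sum_univ_add] at hz
        simpa [hBl, hBr, h2] using hz
      have hz'' : blockIncl N k (∑ i, z (Fin.castAdd k i) • (t i : Fin N → ℚ)) = 0 := by
        rw [map_sum]; simpa only [map_zsmul] using hz'
      have h0 : ∑ i, z (Fin.castAdd k i) • (t i : Fin N → ℚ) = 0 :=
        blockIncl_injective (by rw [hz'', map_zero])
      exact fun i => Fintype.linearIndependent_iff.1 htli (fun i => z (Fin.castAdd k i)) h0 i
    intro r
    exact Fin.addCases (fun i => h1 i) (fun j => h2 j) r
  have hBliQ : LinearIndependent ℚ B := (LinearIndependent.iff_fractionRing ℤ ℚ).1 hBli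
  -- `B` spans `Φ` over `ℤ`
  have hspan : ∀ q ∈ Φ, ∃ z : Fin (N + k) → ℤ, q = ∑ r, z r • B r := by
    intro q hq
    let y : Ψ := ⟨blockSnd N k q, ⟨q, hq, rfl⟩⟩
    let z₂ : Fin k → ℤ := fun j => u.repr y j
    have hy : ∑ j, z₂ j • (u j : Fin k → ℚ) = blockSnd N k q := by
      have := congrArg Ψ.subtype (u.sum_repr y)
      rw [map_sum] at this
      simp only [map_zsmul, Submodule.subtype_apply] at this
      exact this
    set q₀ := q - ∑ j, z₂ j • v j with hq₀
    have hq₀Φ : q₀ ∈ Φ := Submodule.sub_mem _ hq (Submodule.sum_mem _ fun j _ => Submodule.smul_mem _ _ (hvΦ j))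
    have hq₀snd : blockSnd N k q₀ = 0 := by
      rw [hq₀, map_sub, map_sum]
      simp only [map_zsmul, hvu]
      rw [hy, sub_self]
    have hq₀eq : blockIncl N k (blockFst N k q₀) = q₀ := blockIncl_blockFst_of_blockSnd_eq_zero hq₀snd
    have hq₀Φ₁ : blockFst N k q₀ ∈ Φ₁ := by rw [hΦ₁mem, hq₀eq]; exact hq₀Φ
    let y₁ : Φ₁ := ⟨blockFst N k q₀, hq₀Φ₁⟩
    let z₁ : Fin N → ℤ := fun i => t.repr y₁ i
    have hy₁ : ∑ i, z₁ i • (t i : Fin N → ℚ) = blockFst N k q₀ := by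
      have := congrArg Φ₁.subtype (t.sum_repr y₁)
      rw [map_sum] at this
      simp only [map_zsmul, Submodule.subtype_apply] at this
      exact this
    refine ⟨Fin.append z₁ z₂, ?_⟩
    rw [Fin.sum_univ_add]
    simp only [Fin.append_left, Fin.append_right, hBl, hBr]
    have h1 : ∑ i, z₁ i • blockIncl N k (t i : Fin N → ℚ) = q₀ := by
      rw [← hq₀eq, ← hy₁, map_sum]
      simp only [map_zsmul]
    rw [h1, hq₀, sub_add_cancel]
  -- the new tuple
  let x' : Fin (N + k) → F := fun r => pairing x (B r)
  let c' : Fin N → F := fun i => x' (Fin.castAdd k i)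
  let e' : Fin k → F := fun j => x' (Fin.natAdd N j)
  have hx' : Fin.append c' e' = x' := by
    funext r; refine Fin.addCases (fun i => ?_) (fun j => ?_) r
    · rw [Fin.append_left]
    · rw [Fin.append_right]
  have hc' : ∀ i, c' i = pairing c (t i : Fin N → ℚ) := fun i => by
    show pairing x (B (Fin.castAdd k i)) = _
    rw [hBl, hxdef, pairing_append_blockIncl]
  -- integer expansions of the old tuple over the new one
  have hexpand : ∀ s, ∃ z : Fin (N + k) → ℤ, (Pi.single s (1 : ℚ) : Fin (N + k) → ℚ) = ∑ r, z r • B r ∧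
      x s = ∑ r, (z r : ℚ) • x' r := fun s => by
    obtain ⟨z, hz⟩ := hspan _ (single_mem_kummerLattice x s)
    refine ⟨z, hz, ?_⟩
    have := congrArg (pairing x) hz
    rw [pairing_single, one_smul, pairing_sum] at this
    rw [this]
    refine Finset.sum_congr rfl fun r _ => ?_
    rw [pairing_zsmul, Int.cast_smul_eq_zsmul]
  -- the level-`0` fields agree
  have hfield : adjoinPtField K x' = adjoinPtField K x := by
    apply le_antisymm
    · refine IntermediateField.adjoin_le_iff.2 ?_
      rintro _ ⟨r, rfl⟩
      rcases r with r | r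
      · rw [lvGens_inl]
        exact mem_adjoinPtField_of_mem_sup x (Submodule.mem_sup_right (pairing_mem_span x (B r)))
      · rw [lvGens_zero_inr]
        exact hBΦ r
    · refine IntermediateField.adjoin_le_iff.2 ?_
      rintro _ ⟨s, rfl⟩
      obtain ⟨z, -, hz⟩ := hexpand (Sum.elim id id s)
      rcases s with s | s
      · rw [lvGens_inl]
        simp only [Sum.elim_inl, id_eq] at hz
        rw [hz]
        refine SetLike.mem_coe.2 (mem_adjoinPtField_of_mem_sup x' (Submodule.mem_sup_right ?_))
        exact Submodule.sum_mem _ fun r _ => Submodule.smul_mem _ _ (Submodule.subset_span (mem_range_self r))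
      · rw [lvGens_zero_inr]
        simp only [Sum.elim_inr, id_eq] at hz
        have : x s = pairing x' fun r => (z r : ℚ) := by rw [hz]; rfl
        rw [this, exp_pairing_intCast]
        exact SetLike.mem_coe.2 (prod_mem fun r _ => zpow_mem (exp_apply_mem_adjoinPtField x' r) _)
  refine ⟨c', e', fun i => ?_, fun i => ?_, fun j => pairing_mem_span x _, fun s => ?_, ?_, ?_⟩
  · rw [hc']; exact pairing_mem_span c _
  · -- `c i` is an integral combination of the `c' l`
    obtain ⟨z, hz, -⟩ := hexpand (Fin.castAdd k i)
    have h2 : ∀ j, z (Fin.natAdd N j) = 0 := hker z (by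
      rw [← hz, ← blockIncl_single, blockSnd_blockIncl])
    refine ⟨fun l => z (Fin.castAdd k l), ?_⟩
    have hz' : (Pi.single (Fin.castAdd k i) (1 : ℚ) : Fin (N + k) → ℚ) =
        ∑ l, z (Fin.castAdd k l) • blockIncl N k (t l : Fin N → ℚ) := by
      rw [hz, Fin.sum_univ_add]
      simp [hBl, hBr, h2]
    have := congrArg (pairing x) hz'
    rw [pairing_single, one_smul, pairing_sum] at this
    rw [show c i = x (Fin.castAdd k i) by rw [hxdef, Fin.append_left], this]
    refine Finset.sum_congr rfl fun l _ => ?_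
    rw [pairing_zsmul, Int.cast_smul_eq_zsmul, hc' l, hxdef, pairing_append_blockIncl]
  · obtain ⟨z, -, hz⟩ := hexpand s
    exact ⟨z, by rw [hx']; exact hz⟩
  · rw [hx']; exact hfield
  · -- Kummer independence of `exp x'` over `L₁`
    rw [hx']
    intro m hm w ⟨y, hy⟩ r
    have hmQ : (m : ℚ) ≠ 0 := Nat.cast_ne_zero.2 hm.ne'
    -- the candidate vector `qv = ∑ (w r / m) B r`
    let qv : Fin (N + k) → ℚ := ∑ r, ((w r : ℚ) / m) • B r
    have hqv : pairing x qv = ∑ r, ((w r : ℚ) / m) • x' r := by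
      simp only [qv, pairing_sum, pairing_smul]
      rfl
    have hR : ((y : adjoinPtField K x') : F) ^ m = ∏ i, exp (x' i) ^ w i := by
      show (algebraMap (adjoinPtField K x') F y) ^ m = _
      rw [← map_pow, hy, map_prod]
      refine Finset.prod_congr rfl fun i _ => ?_
      rw [map_zpow₀]; rfl
    have hL : exp (pairing x qv) ^ m = ∏ i, exp (x' i) ^ w i := by
      rw [← exp_pairing_intCast x', exp_pairing_pow]
      congr 1
      rw [pairing_smul, hqv, Finset.smul_sum, pairing]
      refine Finset.sum_congr rfl fun r _ => ?_
      rw [smul_smul]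
      congr 1
      field_simp
    have hpow : exp (pairing x qv) ^ m = ((y : adjoinPtField K x') : F) ^ m := hL.trans hR.symm
    -- hence `exp ⟪qv, x⟫ = ζ y ∈ L₁`
    have hy0 : ((y : adjoinPtField K x') : F) ≠ 0 := by
      intro h0
      have : ((y : adjoinPtField K x') : F) ^ m = 0 := by rw [h0, zero_pow hm.ne']
      rw [← hpow] at this
      exact exp_ne_zero _ (pow_eq_zero_iff hm.ne' |>.1 this)
    have hζ : (exp (pairing x qv) / ((y : adjoinPtField K x') : F)) ^ m = 1 := by
      rw [div_pow, hpow, div_self (pow_ne_zero _ hy0)]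
    have hζK : exp (pairing x qv) / ((y : adjoinPtField K x') : F) ∈ K := hK.mem_of_pow_eq_one hm hζ
    have hqvΦ : qv ∈ Φ := by
      rw [hΦ, mem_kummerLattice_iff]
      have : exp (pairing x qv) = (exp (pairing x qv) / ((y : adjoinPtField K x') : F)) * ((y : adjoinPtField K x') : F) := by
        rw [div_mul_cancel₀ _ hy0]
      rw [this]
      refine mul_mem (mem_adjoinPtField_of_mem_base x hζK) ?_
      rw [← hfield]; exact y.2
    obtain ⟨z, hz⟩ := hspan qv hqvΦ
    -- compare coefficients
    have hcoef : ∀ r, (w r : ℚ) / m = z r := by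
      have h0 : ∑ r, ((w r : ℚ) / m - z r) • B r = 0 := by
        simp only [sub_smul, Finset.sum_sub_distrib]
        rw [sub_eq_zero]
        rw [show (∑ r, ((w r : ℚ) / m) • B r) = qv from rfl, hz]
        refine Finset.sum_congr rfl fun r _ => ?_
        rw [Int.cast_smul_eq_zsmul]
      intro r
      have := Fintype.linearIndependent_iff.1 hBliQ _ h0 r
      rwa [sub_eq_zero] at this
    have := hcoef r
    rw [div_eq_iff hmQ] at this
    refine ⟨z r, ?_⟩
    have h' : (w r : ℚ) = ((m : ℤ) * z r : ℤ) := by push_cast; rw [this, mul_comm]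
    exact_mod_cast h'

end GoodBasis

end GammaField

end Literature.NumberTheory.Transcendental
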